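import Summits.HubbardSuperconductivity.HubbardLadder.NeelSignUniformConjecture
import Summits.HubbardSuperconductivity.HubbardLadder.NeelSignOddAxisUniform
import Summits.HubbardSuperconductivity.HubbardLadder.NeelSignPatternC23All
import Summits.HubbardSuperconductivity.HubbardLadder.NeelSignPatternC13S
import Summits.HubbardSuperconductivity.HubbardLadder.NeelSignPatternC22AllEven
import HarnessLib

/-!
# The typed conjecture (S) shell by shell, BY NAME: `NeelSignUniformUpTo 3` proved, `UpTo 4 ↔ cell (0,4)`, `UpTo 5 ↔ cells (0,4), (1,4)`, and the odd axis (HubbardLadder R2, device D53-K2)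

HONEST FRAMING: ladder R1–R4 with certified numbers; no claim on H/H₀.  Reference model only (spin-½ Heisenberg
antiferromagnet on even tori); this file is BOOKKEEPING over landed kernel rows — it proves no new inequality and
asserts nothing about Néel order or the Hubbard model.

`NeelSignUniformConjecture.lean` (#244.1) types clause 1 of the cell's conjecture (S) (STRUCTURE.md §2) as
`Summit.HubbardSuperconductivity.Conjectures.NeelSignUniform` with the truncations `NeelSignUniformUpTo R`
(`a + b ≤ R`), and lists its evidence ledger in prose.  Here the ledger becomes kernel statements:

* `NeelSignCell a b` — the body of (S) at one displacement (`∃ q > 0, ∃ k₀, ∀ k ≥ k₀, q ≤ (-1)^(a+b) c_{2k}(a,b)`), with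
  `neelSignUniform_iff_cell`, `neelSignUniformUpTo_iff_cell`, `neelSignCell_comm`;
* the CELLS OF RECORD: `(0,0)` (`c = 1/4`), `(0,1), (1,1), (0,2), (1,2), (0,3)` (`neelSignPattern_allEven`, every even
  `L ≥ 4`), `(1,3), (2,2)` (`heisRedCorr2_C13_floor`, `heisRedCorr2_C22_floor_allEven`), `(2,3)` (`heisRedCorr2_C23_ceiling_all`,
  every even `L ≥ 8`, unconditional), `(0,5)` (`heisRedCorr2_C05_ceiling_allEven`), and the WHOLE ODD AXIS `(0,2M+1)`,
  `(2M+1,0)` for every `M` (`heisRedCorr2_oddAxis_neelSign[_swap]`, device D53-K1, by `exact`; margins existential,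
  `< 10⁻¹⁷` beyond `(0,9)`);
* the SHELL THEOREMS: `neelSignUniformUpTo_three : NeelSignUniformUpTo 3` (PROVED outright);
  `neelSignUniformUpTo_four_iff : NeelSignUniformUpTo 4 ↔ NeelSignCell 0 4`;
  `neelSignUniformUpTo_five_iff : NeelSignUniformUpTo 5 ↔ NeelSignCell 0 4 ∧ NeelSignCell 1 4` —
  i.e. the `R ≤ 5` truncation of (S) is EXACTLY the two cells `(0,4), (1,4)` that have LP value `0` in the
  L-uniform certificate class of record (STRUCTURE.md §4 N-2, §4.N NULL-1): what is open is named by the kernel.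

Everything is proved from tree theorems; no named facts, no numerical input, zero kit.
[cite: KLS1988JSP, p. 1021] [cite: DLS1978, Theorem 4.2]
-/

noncomputable section

namespace Summit.HubbardSuperconductivity.HubbardLadder

open Literature.MathematicalPhysics.QuantumLattice Summit.HubbardSuperconductivity.Conjectures

/-- Conjecture (S) at ONE displacement `(a, b)` (OPEN in general; tagged `@[conjecture]` like `NeelSignUniform`, of which it
is the pointwise instance: `NeelSignUniform ↔ ∀ a b, NeelSignCell a b` is `Iff.rfl`, `neelSignUniform_iff_cell`): a strict Néel
sign with a positive rational margin, uniform in all even sides `2k ≥ 2k₀`.  The cells proved below are its closed instances.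
HONEST FRAMING: ladder R1–R4 with certified numbers; no claim on H/H₀. [cite: KLS1988JSP, p. 1021] -/
@[conjecture] def NeelSignCell (a b : ℕ) : Prop :=
  ∃ q : ℚ, 0 < q ∧ ∃ k₀ : ℕ, ∀ k : ℕ, k₀ ≤ k → (q : ℝ) ≤ (-1 : ℝ) ^ (a + b) * heisRedCorr2 (2 * k) 1 a b

/-- Bookkeeping (no content): (S) `NeelSignUniform` is the conjunction of its cells, definitionally. [cite: KLS1988JSP, p. 1021] -/
theorem neelSignUniform_iff_cell : NeelSignUniform ↔ ∀ a b : ℕ, NeelSignCell a b := Iff.rfl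

/-- Bookkeeping (no content): the range-`R` truncation `NeelSignUniformUpTo R` of (S) is the conjunction of the cells with
`a + b ≤ R`, definitionally. [cite: KLS1988JSP, p. 1021] -/
theorem neelSignUniformUpTo_iff_cell (R : ℕ) :
    NeelSignUniformUpTo R ↔ ∀ a b : ℕ, a + b ≤ R → NeelSignCell a b := Iff.rfl

/-- Lattice symmetry of the cells: `(a,b) ↔ (b,a)` (`heisRedCorr2_swap`). [cite: KLS1988JSP, eqs. (15)–(25)] -/
theorem neelSignCell_comm {a b : ℕ} : NeelSignCell a b ↔ NeelSignCell b a := by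
  suffices aux : ∀ {a b : ℕ}, NeelSignCell a b → NeelSignCell b a from ⟨aux, aux⟩
  intro a b h
  obtain ⟨q, hq, k₀, hk⟩ := h
  refine ⟨q, hq, max k₀ 1, fun k hkk => ?_⟩
  haveI : NeZero (2 * k) := ⟨by omega⟩
  rw [heisRedCorr2_swap, Nat.add_comm]
  exact hk k (le_trans (le_max_left _ _) hkk)

/-! ### From a landed row to the signed inequality of (S) -/

/-- An even-parity floor row `q ≤ c_{2k}(a,b)` (`k ≥ k₀`) is the signed row of (S) at `(a,b)`. -/
theorem neelSign_row_of_floor {a b : ℕ} (hab : Even (a + b)) (q : ℚ) (k₀ : ℕ)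
    (h : ∀ k : ℕ, k₀ ≤ k → (q : ℝ) ≤ heisRedCorr2 (2 * k) 1 a b) :
    ∀ k : ℕ, k₀ ≤ k → (q : ℝ) ≤ (-1 : ℝ) ^ (a + b) * heisRedCorr2 (2 * k) 1 a b := by
  intro k hk
  rw [Even.neg_one_pow hab, one_mul]
  exact h k hk

/-- An odd-parity ceiling row `c_{2k}(a,b) ≤ -q` (`k ≥ k₀`) is the signed row of (S) at `(a,b)`. -/
theorem neelSign_row_of_ceiling {a b : ℕ} (hab : Odd (a + b)) (q : ℚ) (k₀ : ℕ)
    (h : ∀ k : ℕ, k₀ ≤ k → heisRedCorr2 (2 * k) 1 a b ≤ -(q : ℝ)) :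
    ∀ k : ℕ, k₀ ≤ k → (q : ℝ) ≤ (-1 : ℝ) ^ (a + b) * heisRedCorr2 (2 * k) 1 a b := by
  intro k hk
  rw [Odd.neg_one_pow hab, neg_one_mul]
  have := h k hk
  linarith

/-! ### The cells of record -/

/-- `(0,0)`: `c = 1/4`. [cite: KLS1988JSP, eqs. (15)–(25)] -/
theorem neelSignCell_0_0 : NeelSignCell 0 0 :=
  ⟨1 / 4, by norm_num, 1, neelSign_row_of_floor (a := 0) (b := 0) (by decide) (1 / 4) 1 fun k hk => by
    haveI : NeZero (2 * k) := ⟨by omega⟩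
    rw [heisRedCorr2_zero_zero]
    push_cast
    norm_num⟩

/-- `(0,1)`: `c_L(0,1) ≤ -1/12`, every even `L ≥ 4`. -/
theorem neelSignCell_0_1 : NeelSignCell 0 1 :=
  ⟨1 / 12, by norm_num, 2, neelSign_row_of_ceiling (a := 0) (b := 1) (by decide) (1 / 12) 2 fun k hk => by
    have h := heisRedCorr2_C01_ceiling_allEven (2 * k) (by omega) (even_two_mul k)
    push_cast; linarith⟩

/-- `(1,1)`: `173/10⁴ ≤ c_L(1,1)`, every even `L ≥ 4`. -/
theorem neelSignCell_1_1 : NeelSignCell 1 1 :=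
  ⟨173 / 10000, by norm_num, 2, neelSign_row_of_floor (a := 1) (b := 1) (by decide) (173 / 10000) 2 fun k hk => by
    have h := heisRedCorr2_C11_floor_allEven (2 * k) (by omega) (even_two_mul k)
    push_cast; linarith⟩

/-- `(0,2)`: `37/10⁴ ≤ c_L(0,2)`, every even `L ≥ 4`. -/
theorem neelSignCell_0_2 : NeelSignCell 0 2 :=
  ⟨37 / 10000, by norm_num, 2, neelSign_row_of_floor (a := 0) (b := 2) (by decide) (37 / 10000) 2 fun k hk => by
    have h := heisRedCorr2_C02_floor_allEven (2 * k) (by omega) (even_two_mul k)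
    push_cast; linarith⟩

/-- `(1,2)`: `c_L(1,2) ≤ -41/10⁴`, every even `L ≥ 4`. -/
theorem neelSignCell_1_2 : NeelSignCell 1 2 :=
  ⟨41 / 10000, by norm_num, 2, neelSign_row_of_ceiling (a := 1) (b := 2) (by decide) (41 / 10000) 2 fun k hk => by
    have h := heisRedCorr2_C12_ceiling_allEven (2 * k) (by omega) (even_two_mul k)
    push_cast; linarith⟩

/-- `(0,3)`: `c_L(0,3) ≤ -17/10⁴`, every even `L ≥ 4`. -/
theorem neelSignCell_0_3 : NeelSignCell 0 3 :=
  ⟨17 / 10000, by norm_num, 2, neelSign_row_of_ceiling (a := 0) (b := 3) (by decide) (17 / 10000) 2 fun k hk => by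
    have h := heisRedCorr2_C03_ceiling_allEven (2 * k) (by omega) (even_two_mul k)
    push_cast; linarith⟩

/-- `(1,3)`: `1/1000 ≤ c_{2k}(1,3)`, `k ≥ 7` (device X13). -/
theorem neelSignCell_1_3 : NeelSignCell 1 3 :=
  ⟨1 / 1000, by norm_num, 7, neelSign_row_of_floor (a := 1) (b := 3) (by decide) (1 / 1000) 7 fun k hk => by
    have h := heisRedCorr2_C13_floor k hk
    push_cast at h ⊢; linarith⟩

/-- `(2,2)`: `9/5000 ≤ c_L(2,2)`, every even `L ≥ 6` (device D43). -/
theorem neelSignCell_2_2 : NeelSignCell 2 2 :=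
  ⟨9 / 5000, by norm_num, 3, neelSign_row_of_floor (a := 2) (b := 2) (by decide) (9 / 5000) 3 fun k hk => by
    have h := heisRedCorr2_C22_floor_allEven (2 * k) (by omega) (even_two_mul k)
    push_cast; linarith⟩

/-- `(2,3)`: `c_{2k}(2,3) ≤ -3/5000`, `k ≥ 4` (device D52 + finite rows, unconditional). -/
theorem neelSignCell_2_3 : NeelSignCell 2 3 :=
  ⟨3 / 5000, by norm_num, 4, neelSign_row_of_ceiling (a := 2) (b := 3) (by decide) (3 / 5000) 4 fun k hk => by
    have h := heisRedCorr2_C23_ceiling_all k hk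
    push_cast at h ⊢; linarith⟩

/-- `(0,5)`: `c_L(0,5) ≤ -23/10⁶`, every even `L ≥ 6` (reflection-positivity minor). -/
theorem neelSignCell_0_5 : NeelSignCell 0 5 :=
  ⟨23 / 1000000, by norm_num, 3, neelSign_row_of_ceiling (a := 0) (b := 5) (by decide) (23 / 1000000) 3 fun k hk => by
    have h := heisRedCorr2_C05_ceiling_allEven (2 * k) (by omega) (even_two_mul k)
    push_cast; linarith⟩

/-- **The whole odd axis of (S)**: the cells `(0, 2M+1)` and `(2M+1, 0)` hold for EVERY `M`
(`heisRedCorr2_oddAxis_uniform`, device D53-K1).  HONEST FRAMING: ladder R1–R4 with certified numbers; no claim on H/H₀.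
[cite: DLS1978, Theorem 4.2] [cite: KLS1988JSP, eq. (25)] -/
theorem neelSignCell_oddAxis (M : ℕ) : NeelSignCell 0 (2 * M + 1) ∧ NeelSignCell (2 * M + 1) 0 :=
  ⟨heisRedCorr2_oddAxis_neelSign M, heisRedCorr2_oddAxis_neelSign_swap M⟩

/-! ### The shells -/

/-- **`NeelSignUniformUpTo 3` holds**: every displacement of graph distance `≤ 3` carries a strict, `L`-uniform
Néel sign (cells `(0,0)`, `(0,1)`, `(1,1)`, `(0,2)`, `(1,2)`, `(0,3)` and their transposes; all from
`neelSignPattern_allEven`, every even `L ≥ 4`).  HONEST FRAMING: ladder R1–R4 with certified numbers; no claim on H/H₀.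
[cite: KLS1988JSP, p. 1021] -/
theorem neelSignUniformUpTo_three : NeelSignUniformUpTo 3 := by
  intro a b hab
  exact match a, b, hab with
    | 0, 0, _ => neelSignCell_0_0
    | 0, 1, _ => neelSignCell_0_1
    | 0, 2, _ => neelSignCell_0_2
    | 0, 3, _ => neelSignCell_0_3
    | 0, _ + 4, hab => absurd hab (by omega)
    | 1, 0, _ => neelSignCell_comm.mp neelSignCell_0_1
    | 1, 1, _ => neelSignCell_1_1
    | 1, 2, _ => neelSignCell_1_2
    | 1, _ + 3, hab => absurd hab (by omega)
    | 2, 0, _ => neelSignCell_comm.mp neelSignCell_0_2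
    | 2, 1, _ => neelSignCell_comm.mp neelSignCell_1_2
    | 2, _ + 2, hab => absurd hab (by omega)
    | 3, 0, _ => neelSignCell_comm.mp neelSignCell_0_3
    | 3, _ + 1, hab => absurd hab (by omega)
    | _ + 4, _, hab => absurd hab (by omega)

/-- **Shell 4 is the cell `(0,4)`**: `NeelSignUniformUpTo 4 ↔ NeelSignCell 0 4` (the other distance-4 cells `(1,3)`,
`(2,2)`, `(3,1)` are landed rows; `(4,0)` is `(0,4)` transposed).  `(0,4)` has LP value `0` in the L-uniform class of
record (STRUCTURE.md N-2 / NULL-1).  HONEST FRAMING: ladder R1–R4 with certified numbers; no claim on H/H₀. [cite: KLS1988JSP, p. 1021] -/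
theorem neelSignUniformUpTo_four_iff : NeelSignUniformUpTo 4 ↔ NeelSignCell 0 4 := by
  constructor
  · intro h; exact h 0 4 (by norm_num)
  · intro h04 a b hab
    exact match a, b, hab with
      | 0, 0, _ => neelSignCell_0_0
      | 0, 1, _ => neelSignCell_0_1
      | 0, 2, _ => neelSignCell_0_2
      | 0, 3, _ => neelSignCell_0_3
      | 0, 4, _ => h04
      | 0, _ + 5, hab => absurd hab (by omega)
      | 1, 0, _ => neelSignCell_comm.mp neelSignCell_0_1
      | 1, 1, _ => neelSignCell_1_1
      | 1, 2, _ => neelSignCell_1_2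
      | 1, 3, _ => neelSignCell_1_3
      | 1, _ + 4, hab => absurd hab (by omega)
      | 2, 0, _ => neelSignCell_comm.mp neelSignCell_0_2
      | 2, 1, _ => neelSignCell_comm.mp neelSignCell_1_2
      | 2, 2, _ => neelSignCell_2_2
      | 2, _ + 3, hab => absurd hab (by omega)
      | 3, 0, _ => neelSignCell_comm.mp neelSignCell_0_3
      | 3, 1, _ => neelSignCell_comm.mp neelSignCell_1_3
      | 3, _ + 2, hab => absurd hab (by omega)
      | 4, 0, _ => neelSignCell_comm.mp h04
      | 4, _ + 1, hab => absurd hab (by omega)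
      | _ + 5, _, hab => absurd hab (by omega)

/-- **Shell 5 is the two cells `(0,4)`, `(1,4)`**: `NeelSignUniformUpTo 5 ↔ NeelSignCell 0 4 ∧ NeelSignCell 1 4`
(distance 5: `(0,5)`, `(2,3)`, `(3,2)`, `(5,0)` are landed rows; `(1,4)`, like `(0,4)`, has LP value `0` in the
L-uniform class of record, STRUCTURE.md N-2 / NULL-1).  HONEST FRAMING: ladder R1–R4 with certified numbers; no claim on H/H₀.
[cite: KLS1988JSP, p. 1021] -/
theorem neelSignUniformUpTo_five_iff : NeelSignUniformUpTo 5 ↔ NeelSignCell 0 4 ∧ NeelSignCell 1 4 := by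
  constructor
  · intro h; exact ⟨h 0 4 (by norm_num), h 1 4 (by norm_num)⟩
  · rintro ⟨h04, h14⟩ a b hab
    exact match a, b, hab with
      | 0, 0, _ => neelSignCell_0_0
      | 0, 1, _ => neelSignCell_0_1
      | 0, 2, _ => neelSignCell_0_2
      | 0, 3, _ => neelSignCell_0_3
      | 0, 4, _ => h04
      | 0, 5, _ => neelSignCell_0_5
      | 0, _ + 6, hab => absurd hab (by omega)
      | 1, 0, _ => neelSignCell_comm.mp neelSignCell_0_1
      | 1, 1, _ => neelSignCell_1_1
      | 1, 2, _ => neelSignCell_1_2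
      | 1, 3, _ => neelSignCell_1_3
      | 1, 4, _ => h14
      | 1, _ + 5, hab => absurd hab (by omega)
      | 2, 0, _ => neelSignCell_comm.mp neelSignCell_0_2
      | 2, 1, _ => neelSignCell_comm.mp neelSignCell_1_2
      | 2, 2, _ => neelSignCell_2_2
      | 2, 3, _ => neelSignCell_2_3
      | 2, _ + 4, hab => absurd hab (by omega)
      | 3, 0, _ => neelSignCell_comm.mp neelSignCell_0_3
      | 3, 1, _ => neelSignCell_comm.mp neelSignCell_1_3
      | 3, 2, _ => neelSignCell_comm.mp neelSignCell_2_3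
      | 3, _ + 3, hab => absurd hab (by omega)
      | 4, 0, _ => neelSignCell_comm.mp h04
      | 4, 1, _ => neelSignCell_comm.mp h14
      | 4, _ + 2, hab => absurd hab (by omega)
      | 5, 0, _ => neelSignCell_comm.mp neelSignCell_0_5
      | 5, _ + 1, hab => absurd hab (by omega)
      | _ + 6, _, hab => absurd hab (by omega)

/-- What (S) reduces to through distance 5, in one line: the two cells `(0,4)`, `(1,4)` give the full `R = 5`
truncation (and conversely `NeelSignUniform → NeelSignCell 0 4 ∧ NeelSignCell 1 4` is an instance).
HONEST FRAMING: ladder R1–R4 with certified numbers; no claim on H/H₀. [cite: KLS1988JSP, p. 1021] -/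
theorem neelSignUniformUpTo_five_of_cells (h04 : NeelSignCell 0 4) (h14 : NeelSignCell 1 4) :
    NeelSignUniformUpTo 5 :=
  neelSignUniformUpTo_five_iff.mpr ⟨h04, h14⟩

end Summit.HubbardSuperconductivity.HubbardLadder

end
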